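import Summits.ResolutionOfSingularities.ResolutionOfSingularities.Theorems.HomologicalConductorStrictDropCurveCase
import Summits.ResolutionOfSingularities.ResolutionOfSingularities.Theorems.HomologicalConductorNoZenoIffKernel
import HarnessLib

/-!
# Route `HomologicalConductor`, support item `CurveStep` (stmt-ResolutionOfSingularities-16487)

Calibration of the canonical normalised cohomology-annihilator blow-up tower in dimension one:
for a finitely generated `A ⊆ O ⊆ K = Frac A` (`O` a valuation ring of `K ⊇ k`) of Krull
dimension `1`, the FIRST step `T₁ = loc (nrm (chart T₀))` of the tower `T₀ = loc A`,
`T_(m+1) = loc (nrm (chart T_m))` is already a regular local ring.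

## Proof (`curveStep_proof`)

Pure composition of landed lemmas of the route, no use of Iyengar–Takahashi 2014 Thm 5.4:
* every stage is a `k`-subalgebra of `K`, so `dim T₀ ≤ dim A = 1`
  (`StrictDrop.Birth.CurveCase.ringKrullDim_subalgebra_le_of_affineModel`);
* if `T₀` is regular, the tower is stationary, `T₁ = T₀`
  (`NoZeno.Birth.tower_succ_eq_self_of_isRegularLocalRing`: `ca T₀ = T₀`, so chart, normalisation
  and localisation add nothing);
* if `T₀` is singular of dimension `≤ 1`, the next stage is a normal noetherian local domain of
  dimension `≤ 1` (Krull–Akizuki), hence regular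
  (`StrictDrop.Birth.DimLEOne.stub_dimLEOne_succ_regular`, fed by the tower-shape invariant
  `StrictDrop.Birth.TowerShape.stub_towerShape`).

The statement is the route item verbatim (its `let`-telescope is definitionally the named tower of
`Theorems/HomologicalConductorNoZenoBirthDefs.lean`).

References: H. Matsumura, *Commutative Ring Theory*, Thm. 11.7 (Krull–Akizuki) [`Matsumura1987`];
J. Kollár, *Lectures on Resolution of Singularities*, Thm. 1.101 [`Kollar2007`].
-/

noncomputable section

-- single-problem summit: the doubled namespace component is forced
set_option linter.dupNamespace false

namespace Summit.ResolutionOfSingularities.ResolutionOfSingularities.Theorems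

open Summit.ResolutionOfSingularities.ResolutionOfSingularities.Theses.HomologicalConductor

/-- **Support item `CurveStep` of route `HomologicalConductor`** (calibration in dimension one):
for `A` of Krull dimension `1` the first step `T₁` of the canonical normalised `ca`-tower along any
valuation ring `O ⊇ A` of `K = Frac A` is a regular local ring — `T₀` regular makes the tower
stationary, `T₀` singular (of dimension `≤ 1`) is followed by a normal noetherian local domain of
dimension `≤ 1` (Krull–Akizuki), i.e. a field or a DVR. [cite: Matsumura1987, Thm. 11.7] -/
theorem curveStep_proof : CurveStep := by
  intro p hp k K _ _ _ _ O A hk hfg hfrac hle hdimA ca loc chart nrm tower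
  have hshape := StrictDrop.Birth.TowerShape.stub_towerShape p hp k K O A hk hfg hfrac hle
  by_cases hreg : IsRegularLocalRing ↥(tower A 0)
  · -- a regular stage is terminal: `T₁ = T₀`
    have h : tower A (0 + 1) = tower A 0 :=
      NoZeno.Birth.tower_succ_eq_self_of_isRegularLocalRing O A hk hfrac hle 0 hreg
    rw [Nat.zero_add] at h
    rw [h]
    exact hreg
  · -- a singular stage of dimension `≤ 1` is followed by a regular one (Krull–Akizuki)
    have hdim : ringKrullDim ↥(tower A 0) ≤ 1 :=
      (StrictDrop.Birth.CurveCase.ringKrullDim_subalgebra_le_of_affineModel A hfg hfrac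
        (tower A 0)).trans hdimA.le
    exact StrictDrop.Birth.DimLEOne.stub_dimLEOne_succ_regular p hp k K O A hk hfg hfrac hle
      hshape 0 hdim hreg

end Summit.ResolutionOfSingularities.ResolutionOfSingularities.Theorems

end
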